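import Literature.Geometry.Lorentzian.BogovskiiVectorFrozenOperator
import Literature.Geometry.Lorentzian.BogovskiiH2Bound
import HarnessLib

/-!
# (T3), gain of one derivative: the decomposition of `SV_η(∂_b g)` and the `Ḣ¹` bounds for `SV_η` and `T_η`

(trunk G08 = T-LORENTZ; family `gr`; namespace `Literature.Geometry.Lorentzian.MaoOhTao`.)

Mao–Oh–Tao (arXiv:2308.13031), Lemma 2.3 (T3): `T_η : L²(B̄_ρ) → Ḣ¹`.  Vector analogue of `BogovskiiH2Bound`:
the gain-one term of `∂_b SV_η g = SV_{∂_bη} g + SV_η(∂_b g)` is `SV_η(∂_b g)(x) = ∫ Φ_a(x − y; y) ∂_b g(y) dy`,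
`Φ_a(z; y) = z_a Q₂[η](z; y)` (degree `−2`).  With `θ_ε = radialCutoff ε (2ε)`:

* `SV_η(∂_b g) = N_ε + F_ε` (`bogovskiiSV_pd_eq_add`); `F_ε = A_ε − B_ε − L_ε` by one integration by parts against
  `u(y) = (1 − θ_ε(x − y))Φ_a(x − y; y)` (`integral_truncV_section_mul_pd_eq`; `∂_{y_b}[Φ_a(x − y; y)] =
  −KV + Φ_a[∂_bη]`, `fderiv_vectorKernel_section_e`); `A_ε = 1_{B̄}(TV_ε[η](x, x) + E_ε)` (`czVTerm_eq_frozen_add`);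
* Schur bounds for `N_ε` (`O(ε)`), `B_ε`, `L_ε`, `E_ε`, the diagonal bound `exists_diagFrozenVOp_l2Const`, `ε → 0`:
  `exists_czConst_bogovskiiSV_pd`;
* `exists_h1Const_bogovskiiSV`: `∫ |∂_b (SV_η g)_a|² ≤ C ∫ |g|²` (`g ∈ C¹_c(B̄_ρ)`, `η ∈ C⁶_c`);
* `exists_h1Const_bogovskiiT`: **(T3), gain one** — `∫ |∂_l (T_η F)^{ij}|² ≤ C Σ_k ∫ |F_k|²` (`F ∈ C²_c(B̄_ρ)`,
  `η ∈ C⁷_c`), from `pd_bogovskiiT`, the gain-one bound for `SV_η` and the gain-two bound `exists_h2Const_bogovskiiS`.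

## References

* Y. Mao, S.-J. Oh, T. Tao, arXiv:2308.13031 (2023), Lemma 2.3, pp. 8–9 (key `MaoOhTao2023`).
* L. Grafakos, *Classical Fourier Analysis*, 3rd ed., Thm. 5.4.1; *Modern Fourier Analysis*, App. A.2 (Schur).
-/

noncomputable section

open scoped RealInnerProductSpace Topology ENNReal
open Filter MeasureTheory Set Metric Function
open Literature.Analysis.FluidPDE

namespace Literature.Geometry.Lorentzian

namespace MaoOhTao

section VSection

variable {η : E3 → ℝ} {R : ℝ}

/-- **Derivative of the section of the vector kernel**: for `η ∈ C¹` and `y ≠ x`,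
`∂_{y_b}[(x − y)_a Q₂[η](x − y; y)] = −KV[η](x − y; y) + (x − y)_a Q₂[∂_bη](x − y; y)`. [cite: MaoOhTao2023, Lemma 2.3] -/
theorem fderiv_vectorKernel_section_e (hη : ContDiff ℝ 1 η) (hR : ∀ z : E3, R < ‖z‖ → η z = 0) (a : Fin 3) (x : E3)
    {y : E3} (hy : y ≠ x) (b : Fin 3) :
    DifferentiableAt ℝ (fun y : E3 ↦ (x - y) a * bogovskiiQ η y 2 (x - y)) y ∧
      fderiv ℝ (fun y : E3 ↦ (x - y) a * bogovskiiQ η y 2 (x - y)) y (e b) =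
        -bogovskiiKV η y a b (x - y) + (x - y) a * bogovskiiQ (pd b η) y 2 (x - y) := by
  obtain ⟨dQ2, fQ2⟩ := fderiv_bogovskiiQ_section_e hη hR 2 x hy b
  have hca : HasFDerivAt (fun y : E3 ↦ (x - y) a) (-(EuclideanSpace.proj (𝕜 := ℝ) a : E3 →L[ℝ] ℝ)) y := by
    have := ((hasFDerivAt_const (𝕜 := ℝ) x y).sub (hasFDerivAt_id y))
    have h2 := (EuclideanSpace.proj (𝕜 := ℝ) a).hasFDerivAt.comp y this
    refine h2.congr_fderiv ?_
    ext v
    simp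
  have dxa : DifferentiableAt ℝ (fun y : E3 ↦ (x - y) a) y := hca.differentiableAt
  have fxa : fderiv ℝ (fun y : E3 ↦ (x - y) a) y (e b) = -(if a = b then 1 else 0) := by
    rw [hca.fderiv]
    simp [e, PiLp.single_apply]
  refine ⟨dxa.mul dQ2, ?_⟩
  rw [fderiv_fun_mul dxa dQ2]
  simp only [_root_.add_apply, _root_.smul_apply, smul_eq_mul, fQ2, fxa]
  simp only [bogovskiiKV]
  ring

/-- The section `y ↦ (x − y)_a Q₂[η](x − y; y)` is continuous off `x` (`η ∈ C¹`). [folklore] -/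
theorem continuousOn_vectorKernel_section (hη : ContDiff ℝ 1 η) (hR : ∀ z : E3, R < ‖z‖ → η z = 0) (a : Fin 3)
    (x : E3) : ContinuousOn (fun y : E3 ↦ (x - y) a * bogovskiiQ η y 2 (x - y)) {x}ᶜ := fun _ hy ↦
  ((fderiv_vectorKernel_section_e hη hR a x hy a).1).continuousAt.continuousWithinAt

/-- The section `y ↦ KV[η](x − y; y)` is continuous at `y ≠ x` (`η ∈ C²`). [folklore] -/
theorem continuousAt_bogovskiiKV_section (hη : ContDiff ℝ 2 η) (hR : ∀ z : E3, R < ‖z‖ → η z = 0) (a b : Fin 3)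
    (x : E3) {y : E3} (hy : y ≠ x) : ContinuousAt (fun y : E3 ↦ bogovskiiKV η y a b (x - y)) y := by
  have h1 : ContDiff ℝ 1 η := hη.of_le (by norm_cast)
  obtain ⟨hbη, hRb⟩ := contDiff_pd_and_vanish (n := 1) hη hR b
  have cQ2 := (hasFDerivAt_bogovskiiQ_section h1 hR 2 x hy).continuousAt
  have cQ3 := (hasFDerivAt_bogovskiiQ_section hbη hRb 3 x hy).continuousAt
  have cxa : ContinuousAt (fun y : E3 ↦ (x - y) a) y :=
    ((EuclideanSpace.proj (𝕜 := ℝ) a).continuous.comp (continuous_const.sub continuous_id)).continuousAt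
  unfold bogovskiiKV
  exact (continuousAt_const.mul cQ2).add (cxa.mul cQ3)

end VSection

section VTruncatedSection

variable {η : E3 → ℝ} {R ε : ℝ}

/-- **The truncated vector section `u(y) = (1 − θ_ε(x − y)) (x − y)_a Q₂[η](x − y; y)` is differentiable
everywhere**, with `∂_{y_b} u = (∂_bθ_ε)(x − y)Φ_a − (1 − θ_ε(x − y)) KV[η](x − y; y) + (1 − θ_ε(x − y)) Φ_a[∂_bη]`.
[cite: MaoOhTao2023, Lemma 2.3 (T3)] -/
theorem fderiv_truncV_section_e (hη : ContDiff ℝ 1 η) (hR : ∀ z : E3, R < ‖z‖ → η z = 0) (hε : 0 < ε)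
    (a b : Fin 3) (x y : E3) :
    DifferentiableAt ℝ (fun y : E3 ↦ (1 - radialCutoff ε (2 * ε) (x - y)) * ((x - y) a * bogovskiiQ η y 2 (x - y))) y ∧
      fderiv ℝ (fun y : E3 ↦ (1 - radialCutoff ε (2 * ε) (x - y)) * ((x - y) a * bogovskiiQ η y 2 (x - y))) y (e b) =
        fderiv ℝ (radialCutoff ε (2 * ε)) (x - y) (e b) * ((x - y) a * bogovskiiQ η y 2 (x - y)) -
          (1 - radialCutoff ε (2 * ε) (x - y)) * bogovskiiKV η y a b (x - y) +
          (1 - radialCutoff ε (2 * ε) (x - y)) * ((x - y) a * bogovskiiQ (pd b η) y 2 (x - y)) := by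
  have hθs : ContDiff ℝ 1 (radialCutoff ε (2 * ε) : E3 → ℝ) := radialCutoff_contDiff ε (2 * ε)
  by_cases hxy : ‖x - y‖ < ε
  · have ho : IsOpen {w : E3 | ‖x - w‖ < ε} := isOpen_lt (continuous_const.sub continuous_id).norm continuous_const
    have hev : (fun y : E3 ↦ (1 - radialCutoff ε (2 * ε) (x - y)) * ((x - y) a * bogovskiiQ η y 2 (x - y))) =ᶠ[𝓝 y]
        fun _ ↦ 0 := by
      filter_upwards [ho.mem_nhds hxy] with w hw
      rw [radialCutoff_eq_one hε.le (by linarith) hw.le, sub_self, zero_mul]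
    refine ⟨(differentiableAt_const (0 : ℝ)).congr_of_eventuallyEq hev, ?_⟩
    rw [hev.fderiv_eq, fderiv_const_apply, _root_.zero_apply,
      Literature.Analysis.SingularIntegrals.fderiv_radialCutoff_eq_zero_of_lt hε.le (by linarith) hxy,
      radialCutoff_eq_one hε.le (by linarith) hxy.le]
    simp
  · have hyx : y ≠ x := by
      intro h; rw [h, sub_self, norm_zero] at hxy; exact hxy hε
    obtain ⟨dK, fK⟩ := fderiv_vectorKernel_section_e hη hR a x hyx b
    have hg : HasFDerivAt (fun y : E3 ↦ 1 - radialCutoff ε (2 * ε) (x - y))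
        ((fderiv ℝ (radialCutoff ε (2 * ε)) (x - y)).comp (ContinuousLinearMap.id ℝ E3)) y := by
      have h1 : HasFDerivAt (fun y : E3 ↦ x - y) (-(ContinuousLinearMap.id ℝ E3)) y := by
        have := (hasFDerivAt_const (𝕜 := ℝ) x y).sub (hasFDerivAt_id y)
        refine this.congr_fderiv ?_
        ext v; simp
      have h2 := ((hθs.differentiable one_ne_zero) (x - y)).hasFDerivAt.comp y h1
      have h3 := (hasFDerivAt_const (1 : ℝ) y).sub h2
      refine h3.congr_fderiv ?_
      ext v
      simp
    have dg := hg.differentiableAt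
    refine ⟨dg.mul dK, ?_⟩
    rw [fderiv_fun_mul dg dK, hg.fderiv]
    simp only [_root_.add_apply, _root_.smul_apply, smul_eq_mul, ContinuousLinearMap.coe_comp, comp_apply,
      ContinuousLinearMap.coe_id', id_eq, fK]
    ring

/-- The three continuous pieces of `∂_b u` (vector case, `η ∈ C²`). [folklore] -/
theorem continuous_truncVTerms (hη : ContDiff ℝ 2 η) (hR : ∀ z : E3, R < ‖z‖ → η z = 0) (hε : 0 < ε)
    (a b : Fin 3) (x : E3) :
    (Continuous fun y : E3 ↦ fderiv ℝ (radialCutoff ε (2 * ε)) (x - y) (e b) * ((x - y) a * bogovskiiQ η y 2 (x - y))) ∧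
    (Continuous fun y : E3 ↦ (1 - radialCutoff ε (2 * ε) (x - y)) * bogovskiiKV η y a b (x - y)) ∧
    (Continuous fun y : E3 ↦ (1 - radialCutoff ε (2 * ε) (x - y)) * ((x - y) a * bogovskiiQ (pd b η) y 2 (x - y))) := by
  have h1 : ContDiff ℝ 1 η := hη.of_le (by norm_cast)
  obtain ⟨hbη, hRb⟩ := contDiff_pd_and_vanish (n := 1) hη hR b
  have hθs : ContDiff ℝ 1 (radialCutoff ε (2 * ε) : E3 → ℝ) := radialCutoff_contDiff ε (2 * ε)
  have c1 : Continuous fun y : E3 ↦ fderiv ℝ (radialCutoff ε (2 * ε)) (x - y) (e b) :=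
    ((hθs.continuous_fderiv one_ne_zero).comp (continuous_const.sub continuous_id)).clm_apply continuous_const
  have c1z : ∀ y : E3, ‖x - y‖ < ε → fderiv ℝ (radialCutoff ε (2 * ε)) (x - y) (e b) = 0 := fun y hy ↦ by
    rw [Literature.Analysis.SingularIntegrals.fderiv_radialCutoff_eq_zero_of_lt hε.le (by linarith) hy,
      _root_.zero_apply]
  have c2 : Continuous fun y : E3 ↦ 1 - radialCutoff ε (2 * ε) (x - y) :=
    continuous_const.sub (hθs.continuous.comp (continuous_const.sub continuous_id))
  have c2z : ∀ y : E3, ‖x - y‖ < ε → 1 - radialCutoff ε (2 * ε) (x - y) = 0 := fun y hy ↦ by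
    rw [radialCutoff_eq_one hε.le (by linarith) hy.le, sub_self]
  exact ⟨continuous_mul_of_eqOn_ball_pt c1 hε c1z (continuousOn_vectorKernel_section h1 hR a x),
    continuous_mul_of_eqOn_ball_pt c2 hε c2z (c := x) (v := fun y ↦ bogovskiiKV η y a b (x - y))
      fun y hy ↦ (continuousAt_bogovskiiKV_section hη hR a b x hy).continuousWithinAt,
    continuous_mul_of_eqOn_ball_pt c2 hε c2z (continuousOn_vectorKernel_section hbη hRb a x)⟩

/-- The truncated vector section is continuous (`η ∈ C¹`). [folklore] -/
theorem continuous_truncV_section (hη : ContDiff ℝ 1 η) (hR : ∀ z : E3, R < ‖z‖ → η z = 0) (hε : 0 < ε)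
    (a : Fin 3) (x : E3) :
    Continuous fun y : E3 ↦ (1 - radialCutoff ε (2 * ε) (x - y)) * ((x - y) a * bogovskiiQ η y 2 (x - y)) := by
  have hθs : ContDiff ℝ 1 (radialCutoff ε (2 * ε) : E3 → ℝ) := radialCutoff_contDiff ε (2 * ε)
  have c2 : Continuous fun y : E3 ↦ 1 - radialCutoff ε (2 * ε) (x - y) :=
    continuous_const.sub (hθs.continuous.comp (continuous_const.sub continuous_id))
  have c2z : ∀ y : E3, ‖x - y‖ < ε → 1 - radialCutoff ε (2 * ε) (x - y) = 0 := fun y hy ↦ by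
    rw [radialCutoff_eq_one hε.le (by linarith) hy.le, sub_self]
  exact continuous_mul_of_eqOn_ball_pt c2 hε c2z (continuousOn_vectorKernel_section hη hR a x)

/-- **Integration by parts against the truncated vector section, split into the three terms**
(`F_ε = A_ε − B_ε − L_ε`): for `η ∈ C²`, `ε > 0` and `g ∈ C¹_c`. [cite: MaoOhTao2023, Lemma 2.3 (T3)] -/
theorem integral_truncV_section_mul_pd_eq (hη : ContDiff ℝ 2 η) (hR : ∀ z : E3, R < ‖z‖ → η z = 0) (hε : 0 < ε)
    {g : E3 → ℝ} (hg : ContDiff ℝ 1 g) (hgc : HasCompactSupport g) (a b : Fin 3) (x : E3) :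
    ∫ y, (1 - radialCutoff ε (2 * ε) (x - y)) * ((x - y) a * bogovskiiQ η y 2 (x - y)) * pd b g y =
      (∫ y, (1 - radialCutoff ε (2 * ε) (x - y)) * bogovskiiKV η y a b (x - y) * g y) -
        (∫ y, fderiv ℝ (radialCutoff ε (2 * ε)) (x - y) (e b) * ((x - y) a * bogovskiiQ η y 2 (x - y)) * g y) -
        ∫ y, (1 - radialCutoff ε (2 * ε) (x - y)) * ((x - y) a * bogovskiiQ (pd b η) y 2 (x - y)) * g y := by
  have h1 : ContDiff ℝ 1 η := hη.of_le (by norm_cast)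
  have hgcn : Continuous g := hg.continuous
  have hgd : Differentiable ℝ g := hg.differentiable one_ne_zero
  have hpdg : Continuous (pd b g) := by
    unfold pd; exact (hg.continuous_fderiv one_ne_zero).clm_apply continuous_const
  set u : E3 → ℝ := fun y ↦ (1 - radialCutoff ε (2 * ε) (x - y)) * ((x - y) a * bogovskiiQ η y 2 (x - y)) with hu
  have hud : ∀ y, DifferentiableAt ℝ u y := fun y ↦ (fderiv_truncV_section_e h1 hR hε a b x y).1
  have hfu : (fun y ↦ fderiv ℝ u y (e b)) = fun y ↦
      fderiv ℝ (radialCutoff ε (2 * ε)) (x - y) (e b) * ((x - y) a * bogovskiiQ η y 2 (x - y)) -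
        (1 - radialCutoff ε (2 * ε) (x - y)) * bogovskiiKV η y a b (x - y) +
        (1 - radialCutoff ε (2 * ε) (x - y)) * ((x - y) a * bogovskiiQ (pd b η) y 2 (x - y)) :=
    funext fun y ↦ (fderiv_truncV_section_e h1 hR hε a b x y).2
  obtain ⟨c1, c2, c3⟩ := continuous_truncVTerms hη hR hε a b x
  have huc : Continuous u := continuous_truncV_section h1 hR hε a x
  have hfuc : Continuous fun y ↦ fderiv ℝ u y (e b) := by rw [hfu]; exact (c1.sub c2).add c3
  have hI1 : Integrable fun y ↦ fderiv ℝ u y (e b) * g y := (hfuc.mul hgcn).integrable_of_hasCompactSupport hgc.mul_left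
  have hI2 : Integrable fun y ↦ u y * fderiv ℝ g y (e b) :=
    (huc.mul hpdg).integrable_of_hasCompactSupport (hasCompactSupport_pd hgc b).mul_left
  have hI3 : Integrable fun y ↦ u y * g y := (huc.mul hgcn).integrable_of_hasCompactSupport hgc.mul_left
  have hibp := integral_mul_fderiv_eq_neg_fderiv_mul_of_integrable hI1 hI2 hI3 (fun y _ ↦ hud y) fun y _ ↦ hgd y
  have hlhs : (fun y ↦ (1 - radialCutoff ε (2 * ε) (x - y)) * ((x - y) a * bogovskiiQ η y 2 (x - y)) * pd b g y) =
      fun y ↦ u y * fderiv ℝ g y (e b) := rfl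
  rw [hlhs, hibp]
  have hJ1 : Integrable fun y ↦ fderiv ℝ (radialCutoff ε (2 * ε)) (x - y) (e b) *
      ((x - y) a * bogovskiiQ η y 2 (x - y)) * g y := (c1.mul hgcn).integrable_of_hasCompactSupport hgc.mul_left
  have hJ2 : Integrable fun y ↦ (1 - radialCutoff ε (2 * ε) (x - y)) * bogovskiiKV η y a b (x - y) * g y :=
    (c2.mul hgcn).integrable_of_hasCompactSupport hgc.mul_left
  have hJ3 : Integrable fun y ↦ (1 - radialCutoff ε (2 * ε) (x - y)) *
      ((x - y) a * bogovskiiQ (pd b η) y 2 (x - y)) * g y := (c3.mul hgcn).integrable_of_hasCompactSupport hgc.mul_left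
  have hrw : (fun y ↦ fderiv ℝ u y (e b) * g y) = fun y ↦
      (fderiv ℝ (radialCutoff ε (2 * ε)) (x - y) (e b) * ((x - y) a * bogovskiiQ η y 2 (x - y)) * g y -
        (1 - radialCutoff ε (2 * ε) (x - y)) * bogovskiiKV η y a b (x - y) * g y) +
        (1 - radialCutoff ε (2 * ε) (x - y)) * ((x - y) a * bogovskiiQ (pd b η) y 2 (x - y)) * g y := by
    funext y
    have := congrFun hfu y
    simp only at this
    rw [this]; ring
  have h12 : Integrable fun y ↦ fderiv ℝ (radialCutoff ε (2 * ε)) (x - y) (e b) *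
      ((x - y) a * bogovskiiQ η y 2 (x - y)) * g y -
      (1 - radialCutoff ε (2 * ε) (x - y)) * bogovskiiKV η y a b (x - y) * g y := hJ1.sub hJ2
  rw [hrw, integral_add h12 hJ3, integral_sub hJ1 hJ2]
  ring

end VTruncatedSection

section VDecomposition

open scoped ENNReal

variable {η : E3 → ℝ} {R ε : ℝ}

/-- Pointwise majorant of the `θ_ε Φ_a` integrand: `m = 1_{B_{3ε}} A'/|z|²`, `A' = 2MD³`. [folklore] -/
theorem abs_thetaV_le (hη : Continuous η) (hR : ∀ z : E3, R < ‖z‖ → η z = 0) {M : ℝ} (hM0 : ∀ w, |η w| ≤ M)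
    (hε : 0 < ε) {ρ : ℝ} {g : E3 → ℝ} (hgρ : ∀ y, g y ≠ 0 → ‖y‖ ≤ ρ) (a : Fin 3) (x y : E3) (hy : g y ≠ 0) :
    |radialCutoff ε (2 * ε) (x - y) * ((x - y) a * bogovskiiQ η y 2 (x - y))| ≤
      (ball (0 : E3) (3 * ε)).indicator (fun z ↦ 2 * M * (max (R + ρ) 0) ^ 3 / ‖z‖ ^ 2) (x - y) := by
  have hMnn : 0 ≤ M := (abs_nonneg _).trans (hM0 0)
  by_cases hz : 2 * ε < ‖x - y‖
  · rw [radialCutoff_eq_zero hε.le (by linarith) hz.le, zero_mul, abs_zero]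
    exact indicator_nonneg (fun z _ ↦ by positivity) _
  · have hmem : x - y ∈ ball (0 : E3) (3 * ε) := by
      rw [mem_ball, dist_zero_right]; linarith
    rw [indicator_of_mem hmem, abs_mul]
    calc _ ≤ 1 * (2 * M * (max (R + ρ) 0) ^ 3 / ‖x - y‖ ^ 2) :=
          mul_le_mul (abs_radialCutoff_le_one _ _ _) (abs_vectorKernel_le hη hR hM0 (hgρ y hy) a (x - y))
            (abs_nonneg _) zero_le_one
      _ = _ := one_mul _

/-- Integrability of the `θ_ε Φ_a` integrand against a continuous density supported in `B̄_ρ` (`η ∈ C³`). [folklore] -/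
theorem integrable_thetaV_mul (hη : ContDiff ℝ 3 η) (hR : ∀ z : E3, R < ‖z‖ → η z = 0) (hε : 0 < ε) {ρ : ℝ}
    {g : E3 → ℝ} (hg : Continuous g) (hgc : HasCompactSupport g) (hgρ : ∀ y, g y ≠ 0 → ‖y‖ ≤ ρ) (a : Fin 3)
    (x : E3) : Integrable fun y ↦ radialCutoff ε (2 * ε) (x - y) * ((x - y) a * bogovskiiQ η y 2 (x - y)) * g y := by
  have h1 : ContDiff ℝ 1 η := hη.of_le (by norm_cast)
  obtain ⟨M, hM0, -, -, -⟩ := exists_bound_pd_le_three hη hR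
  obtain ⟨Mg, hMg⟩ := hg.bounded_above_of_compact_support hgc
  have hMg0 : 0 ≤ Mg := (norm_nonneg _).trans (hMg 0)
  set A' : ℝ := 2 * M * (max (R + ρ) 0) ^ 3 with hA'
  set m : E3 → ℝ := (ball (0 : E3) (3 * ε)).indicator fun z ↦ A' / ‖z‖ ^ 2 with hm
  have hmi : Integrable fun y ↦ Mg * m (x - y) := ((integrable_ball_inv_sq_majorant A' (3 * ε)).comp_sub_left x).const_mul Mg
  have hθc : Continuous fun y : E3 ↦ radialCutoff ε (2 * ε) (x - y) :=
    (radialCutoff_contDiff (n := 0) ε (2 * ε)).continuous.comp (continuous_const.sub continuous_id)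
  have hmeas : AEStronglyMeasurable
      (fun y ↦ radialCutoff ε (2 * ε) (x - y) * ((x - y) a * bogovskiiQ η y 2 (x - y)) * g y) volume := by
    refine ((hθc.aestronglyMeasurable.mul ?_).mul hg.aestronglyMeasurable)
    exact aestronglyMeasurable_of_continuousOn_compl_singleton' (continuousOn_vectorKernel_section h1 hR a x)
  refine hmi.mono' hmeas (ae_of_all _ fun y ↦ ?_)
  have hMnn : 0 ≤ M := (abs_nonneg _).trans (hM0 0)
  have hm0 : 0 ≤ m (x - y) := indicator_nonneg (fun z _ ↦ by positivity) _
  by_cases hgy : g y = 0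
  · rw [hgy, mul_zero, norm_zero]; positivity
  · rw [Real.norm_eq_abs, abs_mul, mul_comm]
    refine mul_le_mul ?_ (abs_thetaV_le hη.continuous hR hM0 hε hgρ a x y hgy) (abs_nonneg _) hMg0
    exact (Real.norm_eq_abs _).symm.le.trans (hMg y)

/-- **`SV_η(∂_b g) = N_ε + F_ε`**: split of the vector kernel into `θ_εΦ_a` and `(1 − θ_ε)Φ_a`.
[cite: MaoOhTao2023, Lemma 2.3 (T3)] -/
theorem bogovskiiSV_pd_eq_add (hη : ContDiff ℝ 3 η) (hR : ∀ z : E3, R < ‖z‖ → η z = 0) (hε : 0 < ε) {ρ : ℝ}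
    {g : E3 → ℝ} (hg : ContDiff ℝ 1 g) (hgc : HasCompactSupport g) (hgρ : ∀ y, g y ≠ 0 → ‖y‖ ≤ ρ) (a b : Fin 3)
    (x : E3) :
    bogovskiiSV η (pd b g) a x =
      (∫ y, radialCutoff ε (2 * ε) (x - y) * ((x - y) a * bogovskiiQ η y 2 (x - y)) * pd b g y) +
        ∫ y, (1 - radialCutoff ε (2 * ε) (x - y)) * ((x - y) a * bogovskiiQ η y 2 (x - y)) * pd b g y := by
  have h1 : ContDiff ℝ 1 η := hη.of_le (by norm_cast)
  have hpg : Continuous (pd b g) := by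
    unfold pd; exact (hg.continuous_fderiv one_ne_zero).clm_apply continuous_const
  have hpgc : HasCompactSupport (pd b g) := hasCompactSupport_pd hgc b
  have hpgρ : ∀ y, pd b g y ≠ 0 → ‖y‖ ≤ ρ := norm_le_of_pd_ne_zero hgρ b
  rw [bogovskiiSV_eq_integral_vectorKernel]
  have hN := integrable_thetaV_mul hη hR hε hpg hpgc hpgρ a x
  have hF : Integrable fun y ↦ (1 - radialCutoff ε (2 * ε) (x - y)) * ((x - y) a * bogovskiiQ η y 2 (x - y)) * pd b g y :=
    ((continuous_truncV_section h1 hR hε a x).mul hpg).integrable_of_hasCompactSupport hpgc.mul_left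
  rw [← integral_add hN hF]
  refine integral_congr_ae (ae_of_all _ fun y ↦ ?_)
  ring

/-- **Freezing the base point at the output point** (vector case): with `ζ = 1_{B̄_{D_x}}`, `D_x = max (R + 2ρ) ρ`,
`A_ε(x) = ζ(x)(TV_ε[η](x, x) + E_ε(x))`. [cite: MaoOhTao2023, Lemma 2.3 (T3)] -/
theorem czVTerm_eq_frozen_add (hη : ContDiff ℝ 2 η) (hR : ∀ z : E3, R < ‖z‖ → η z = 0) (hε : 0 < ε) {ρ : ℝ}
    {g : E3 → ℝ} (hg : Continuous g) (hgc : HasCompactSupport g) (hgρ : ∀ y, g y ≠ 0 → ‖y‖ ≤ ρ) (a b : Fin 3)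
    (x : E3) :
    ∫ y, (1 - radialCutoff ε (2 * ε) (x - y)) * bogovskiiKV η y a b (x - y) * g y =
      (closedBall (0 : E3) (max (R + 2 * ρ) ρ)).indicator (fun _ ↦ (1 : ℝ)) x *
        ((∫ t, (1 - radialCutoff ε (2 * ε) t) * bogovskiiKV η x a b t * g (x - t)) +
          ∫ y, (1 - radialCutoff ε (2 * ε) (x - y)) *
            (bogovskiiKV η y a b (x - y) - bogovskiiKV η x a b (x - y)) * g y) := by
  by_cases hx : x ∈ closedBall (0 : E3) (max (R + 2 * ρ) ρ)
  · rw [indicator_of_mem hx, one_mul]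
    have hfr : Continuous fun y : E3 ↦ (1 - radialCutoff ε (2 * ε) (x - y)) * bogovskiiKV η x a b (x - y) :=
      (continuous_truncKV hη hR hε a b x).comp (continuous_const.sub continuous_id)
    obtain ⟨-, c2, -⟩ := continuous_truncVTerms hη hR hε a b x
    have hI1 : Integrable fun y ↦ (1 - radialCutoff ε (2 * ε) (x - y)) * bogovskiiKV η x a b (x - y) * g y :=
      (hfr.mul hg).integrable_of_hasCompactSupport hgc.mul_left
    have hI2 : Integrable fun y ↦ (1 - radialCutoff ε (2 * ε) (x - y)) *
        (bogovskiiKV η y a b (x - y) - bogovskiiKV η x a b (x - y)) * g y := by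
      have : (fun y ↦ (1 - radialCutoff ε (2 * ε) (x - y)) *
          (bogovskiiKV η y a b (x - y) - bogovskiiKV η x a b (x - y)) * g y) =
          fun y ↦ (1 - radialCutoff ε (2 * ε) (x - y)) * bogovskiiKV η y a b (x - y) * g y -
            (1 - radialCutoff ε (2 * ε) (x - y)) * bogovskiiKV η x a b (x - y) * g y := by
        funext y; ring
      rw [this]
      exact ((c2.mul hg).integrable_of_hasCompactSupport hgc.mul_left).sub hI1
    have hsub : (∫ t, (1 - radialCutoff ε (2 * ε) t) * bogovskiiKV η x a b t * g (x - t)) =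
        ∫ y, (1 - radialCutoff ε (2 * ε) (x - y)) * bogovskiiKV η x a b (x - y) * g y := by
      rw [← integral_sub_left_eq_self (fun t ↦ (1 - radialCutoff ε (2 * ε) t) * bogovskiiKV η x a b t * g (x - t))
        volume x]
      refine integral_congr_ae (ae_of_all _ fun y ↦ ?_)
      simp only [sub_sub_cancel]
    rw [hsub, ← integral_add hI1 hI2]
    refine integral_congr_ae (ae_of_all _ fun y ↦ ?_)
    ring
  · rw [indicator_of_notMem hx, zero_mul]
    refine integral_eq_zero_of_ae (ae_of_all _ fun y ↦ ?_)
    by_cases hgy : g y = 0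
    · simp [hgy]
    · have hyρ := hgρ y hgy
      rw [mem_closedBall, dist_zero_right, not_le, max_lt_iff] at hx
      have hz : max (R + ‖y‖) 0 < ‖x - y‖ := by
        have h1 : ‖x‖ - ‖y‖ ≤ ‖x - y‖ := norm_sub_norm_le x y
        rw [max_lt_iff]
        constructor <;> linarith
      show (1 - radialCutoff ε (2 * ε) (x - y)) * bogovskiiKV η y a b (x - y) * g y = 0
      rw [bogovskiiKV_eq_zero_of_lt hR y a b hz, mul_zero, zero_mul]

end VDecomposition


section VSchurBounds

open scoped ENNReal

variable {η : E3 → ℝ} {R ε : ℝ}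

/-- **Bound for `N_ε` (vector case)**: `∫ |N_ε|² ≤ (∫ m_N)² ∫ |g|²`, `m_N = 1_{B_{3ε}} A'/|z|²`, `A' = 2MD³`,
`∫ m_N = 9|B₁|A'ε`. [cite: MaoOhTao2023, Lemma 2.3 (T3)] -/
theorem lintegral_sq_thetaV_le (hη : Continuous η) (hR : ∀ z : E3, R < ‖z‖ → η z = 0) {M : ℝ}
    (hM0 : ∀ w, |η w| ≤ M) (hε : 0 < ε) {ρ : ℝ} {g : E3 → ℝ} (hgm : Measurable g)
    (hgρ : ∀ y, g y ≠ 0 → ‖y‖ ≤ ρ) (a : Fin 3) :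
    ∫⁻ x, ‖∫ y, radialCutoff ε (2 * ε) (x - y) * ((x - y) a * bogovskiiQ η y 2 (x - y)) * g y‖ₑ ^ (2 : ℝ) ≤
      ENNReal.ofReal (3 * (volume : Measure E3).real (ball 0 1) * (2 * M * (max (R + ρ) 0) ^ 3) * (3 * ε)) ^
          ((2 : ℝ) / 2) *
        ENNReal.ofReal (3 * (volume : Measure E3).real (ball 0 1) * (2 * M * (max (R + ρ) 0) ^ 3) * (3 * ε)) *
        ∫⁻ y, ‖g y‖ₑ ^ (2 : ℝ) := by
  have hMnn : 0 ≤ M := (abs_nonneg _).trans (hM0 0)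
  set A' : ℝ := 2 * M * (max (R + ρ) 0) ^ 3 with hA'
  have hA'0 : 0 ≤ A' := by positivity
  set m : E3 → ℝ := (ball (0 : E3) (3 * ε)).indicator fun z ↦ A' / ‖z‖ ^ 2 with hm
  have hk := measurable_ofReal_ball_indicator A' (3 * ε)
  have hCk : ∫⁻ z, ENNReal.ofReal (m z) = ENNReal.ofReal (3 * (volume : Measure E3).real (ball 0 1) * A' * (3 * ε)) :=
    lintegral_ball_inv_sq_majorant hA'0 (by positivity)
  have h := lintegral_sq_le_of_conv_majorant hk hgm
    (F := fun x ↦ ∫ y, radialCutoff ε (2 * ε) (x - y) * ((x - y) a * bogovskiiQ η y 2 (x - y)) * g y)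
    (fun x ↦ enorm_integral_kernel_le
      (κ := fun x y ↦ radialCutoff ε (2 * ε) (x - y) * ((x - y) a * bogovskiiQ η y 2 (x - y)))
      x (fun y hy ↦ abs_thetaV_le hη hR hM0 hε hgρ a x y hy))
  rwa [hCk] at h

/-- **Bound for `B_ε` (vector case)**: constant majorant `1_{B_{3ε}} Bε⁻¹A'ε⁻²`, `∫ m_B = 27BA'|B₁|`.
[cite: MaoOhTao2023, Lemma 2.3 (T3)] -/
theorem lintegral_sq_dthetaV_le (hη : Continuous η) (hR : ∀ z : E3, R < ‖z‖ → η z = 0) {M : ℝ}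
    (hM0 : ∀ w, |η w| ≤ M) {B : ℝ} (hB0 : 0 ≤ B)
    (hB : ∀ ε : ℝ, 0 < ε → ∀ z : E3, ‖fderiv ℝ (radialCutoff ε (2 * ε)) z‖ ≤ B * ε⁻¹) (hε : 0 < ε) {ρ : ℝ}
    {g : E3 → ℝ} (hgm : Measurable g) (hgρ : ∀ y, g y ≠ 0 → ‖y‖ ≤ ρ) (a b : Fin 3) :
    ∫⁻ x, ‖∫ y, fderiv ℝ (radialCutoff ε (2 * ε)) (x - y) (e b) * ((x - y) a * bogovskiiQ η y 2 (x - y)) * g y‖ₑ ^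
        (2 : ℝ) ≤
      ENNReal.ofReal (B * (2 * M * (max (R + ρ) 0) ^ 3) * (27 * (volume : Measure E3).real (ball 0 1))) ^
          ((2 : ℝ) / 2) *
        ENNReal.ofReal (B * (2 * M * (max (R + ρ) 0) ^ 3) * (27 * (volume : Measure E3).real (ball 0 1))) *
        ∫⁻ y, ‖g y‖ₑ ^ (2 : ℝ) := by
  have hMnn : 0 ≤ M := (abs_nonneg _).trans (hM0 0)
  set A' : ℝ := 2 * M * (max (R + ρ) 0) ^ 3 with hA'
  have hA'0 : 0 ≤ A' := by positivity
  set c : ℝ := B * ε⁻¹ * (A' / ε ^ 2) with hc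
  have hc0 : 0 ≤ c := by positivity
  set m : E3 → ℝ := (ball (0 : E3) (3 * ε)).indicator fun _ ↦ c with hm
  have hk : Measurable fun z : E3 ↦ ENNReal.ofReal (m z) :=
    ENNReal.measurable_ofReal.comp (measurable_const.indicator measurableSet_ball)
  have hCk : ∫⁻ z, ENNReal.ofReal (m z) = ENNReal.ofReal (B * A' * (27 * (volume : Measure E3).real (ball 0 1))) := by
    rw [hm, lintegral_ball_const_majorant hc0 (by positivity)]
    congr 1
    rw [hc]; field_simp; ring
  have hpt : ∀ x y, g y ≠ 0 →
      |fderiv ℝ (radialCutoff ε (2 * ε)) (x - y) (e b) * ((x - y) a * bogovskiiQ η y 2 (x - y))| ≤ m (x - y) := by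
    intro x y hy
    set z := x - y with hz
    have h1 : |fderiv ℝ (radialCutoff ε (2 * ε)) z (e b)| ≤
        (closedBall (0 : E3) (2 * ε) \ ball 0 ε).indicator (fun _ ↦ B * ε⁻¹) z := by
      have := Literature.Analysis.SingularIntegrals.norm_fderiv_radialCutoff_eps_le_indicator hB hε z
      refine le_trans ?_ this
      rw [← Real.norm_eq_abs]
      calc ‖fderiv ℝ (radialCutoff ε (2 * ε)) z (e b)‖ ≤ ‖fderiv ℝ (radialCutoff ε (2 * ε)) z‖ * ‖e b‖ :=
            ContinuousLinearMap.le_opNorm _ _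
        _ ≤ ‖fderiv ℝ (radialCutoff ε (2 * ε)) z‖ * 1 := by
            gcongr; simp [e]
        _ = _ := mul_one _
    by_cases hmem : z ∈ closedBall (0 : E3) (2 * ε) \ ball 0 ε
    · rw [indicator_of_mem hmem] at h1
      have hzε : ε ≤ ‖z‖ := by simpa using hmem.2
      have hz2 : ‖z‖ ≤ 2 * ε := by simpa using hmem.1
      have hzb : z ∈ ball (0 : E3) (3 * ε) := by rw [mem_ball, dist_zero_right]; linarith
      rw [hm, indicator_of_mem hzb, abs_mul]
      calc _ ≤ B * ε⁻¹ * (A' / ‖z‖ ^ 2) :=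
            mul_le_mul h1 (abs_vectorKernel_le hη hR hM0 (hgρ y hy) a z) (abs_nonneg _) (by positivity)
        _ ≤ B * ε⁻¹ * (A' / ε ^ 2) := by gcongr
    · rw [indicator_of_notMem hmem] at h1
      have h0 : fderiv ℝ (radialCutoff ε (2 * ε)) z (e b) = 0 := abs_nonpos_iff.1 h1
      rw [h0, zero_mul, abs_zero]
      exact indicator_nonneg (fun _ _ ↦ hc0) _
  have h := lintegral_sq_le_of_conv_majorant hk hgm
    (F := fun x ↦ ∫ y, fderiv ℝ (radialCutoff ε (2 * ε)) (x - y) (e b) * ((x - y) a * bogovskiiQ η y 2 (x - y)) * g y)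
    (fun x ↦ enorm_integral_kernel_le
      (κ := fun x y ↦ fderiv ℝ (radialCutoff ε (2 * ε)) (x - y) (e b) * ((x - y) a * bogovskiiQ η y 2 (x - y))) x
      (fun y hy ↦ hpt x y hy))
  rwa [hCk] at h

/-- **Bound for `L_ε` (vector case)**: `m_L = 1_{B_{D'+1}} A'/|z|²`, `A' = 2MD³` with `M ≥ |∂η|`, `D' = (R + ρ)₊`.
[cite: MaoOhTao2023, Lemma 2.3 (T3)] -/
theorem lintegral_sq_truncVpd_le (hη : ContDiff ℝ 1 η) (hR : ∀ z : E3, R < ‖z‖ → η z = 0) {M : ℝ}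
    (hM1 : ∀ a w, |pd a η w| ≤ M) (ε : ℝ) {ρ : ℝ} {g : E3 → ℝ}
    (hgm : Measurable g) (hgρ : ∀ y, g y ≠ 0 → ‖y‖ ≤ ρ) (a b : Fin 3) :
    ∫⁻ x, ‖∫ y, (1 - radialCutoff ε (2 * ε) (x - y)) * ((x - y) a * bogovskiiQ (pd b η) y 2 (x - y)) * g y‖ₑ ^
        (2 : ℝ) ≤
      ENNReal.ofReal (3 * (volume : Measure E3).real (ball 0 1) *
          (2 * M * (max (R + ρ) 0) ^ 3) * (max (R + ρ) 0 + 1)) ^ ((2 : ℝ) / 2) *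
        ENNReal.ofReal (3 * (volume : Measure E3).real (ball 0 1) *
          (2 * M * (max (R + ρ) 0) ^ 3) * (max (R + ρ) 0 + 1)) *
        ∫⁻ y, ‖g y‖ₑ ^ (2 : ℝ) := by
  obtain ⟨hbη, hRb⟩ := contDiff_pd_and_vanish (n := 0) hη hR b
  have hMnn : 0 ≤ M := (abs_nonneg _).trans (hM1 0 0)
  set D' : ℝ := max (R + ρ) 0 with hD'
  have hD'0 : 0 ≤ D' := le_max_right _ _
  set A' : ℝ := 2 * M * D' ^ 3 with hA'
  have hA'0 : 0 ≤ A' := by positivity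
  set m : E3 → ℝ := (ball (0 : E3) (D' + 1)).indicator fun z ↦ A' / ‖z‖ ^ 2 with hm
  have hk := measurable_ofReal_ball_indicator A' (D' + 1)
  have hCk : ∫⁻ z, ENNReal.ofReal (m z) = ENNReal.ofReal (3 * (volume : Measure E3).real (ball 0 1) * A' * (D' + 1)) :=
    lintegral_ball_inv_sq_majorant hA'0 (by positivity)
  have hpt : ∀ x y, g y ≠ 0 →
      |(1 - radialCutoff ε (2 * ε) (x - y)) * ((x - y) a * bogovskiiQ (pd b η) y 2 (x - y))| ≤ m (x - y) := by
    intro x y hy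
    set z := x - y with hz
    by_cases hzb : z ∈ ball (0 : E3) (D' + 1)
    · rw [hm, indicator_of_mem hzb, abs_mul]
      calc _ ≤ 1 * (A' / ‖z‖ ^ 2) :=
            mul_le_mul (Literature.Analysis.SingularIntegrals.abs_one_sub_radialCutoff_le ε z)
              (abs_vectorKernel_le hbη.continuous hRb (hM1 b) (hgρ y hy) a z) (abs_nonneg _) zero_le_one
        _ = _ := one_mul _
    · rw [hm, indicator_of_notMem hzb]
      rw [mem_ball, dist_zero_right, not_lt] at hzb
      have hvan : max (R + ‖y‖) 0 < ‖z‖ := by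
        calc max (R + ‖y‖) 0 ≤ D' := max_le_max (by linarith [hgρ y hy]) le_rfl
          _ < ‖z‖ := by linarith
      rw [vectorKernel_eq_zero_of_lt hRb y a hvan, mul_zero, abs_zero]
  have h := lintegral_sq_le_of_conv_majorant hk hgm
    (F := fun x ↦ ∫ y, (1 - radialCutoff ε (2 * ε) (x - y)) * ((x - y) a * bogovskiiQ (pd b η) y 2 (x - y)) * g y)
    (fun x ↦ enorm_integral_kernel_le
      (κ := fun x y ↦ (1 - radialCutoff ε (2 * ε) (x - y)) * ((x - y) a * bogovskiiQ (pd b η) y 2 (x - y))) x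
      (fun y hy ↦ hpt x y hy))
  rwa [hCk] at h

/-- **Bound for the freezing error `E_ε` (vector case)**: `|KV(x − y; y) − KV(x − y; x)| ≤ C/|x − y|²` on `|x| ≤ D_x`.
[cite: MaoOhTao2023, Lemma 2.3 (T3)] -/
theorem lintegral_sq_freezeVError_le (hη : ContDiff ℝ 2 η) (hR : ∀ z : E3, R < ‖z‖ → η z = 0) {M : ℝ}
    (hM1 : ∀ a w, |pd a η w| ≤ M) (hM2 : ∀ a b w, |pd a (pd b η) w| ≤ M)
    (ε : ℝ) {ρ Dx : ℝ} {g : E3 → ℝ} (hgm : Measurable g) (hgρ : ∀ y, g y ≠ 0 → ‖y‖ ≤ ρ) (a b : Fin 3) :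
    ∫⁻ x, ‖(closedBall (0 : E3) Dx).indicator (fun _ ↦ (1 : ℝ)) x *
        ∫ y, (1 - radialCutoff ε (2 * ε) (x - y)) *
          (bogovskiiKV η y a b (x - y) - bogovskiiKV η x a b (x - y)) * g y‖ₑ ^ (2 : ℝ) ≤
      ENNReal.ofReal (3 * (volume : Measure E3).real (ball 0 1) *
          (3 * M * (2 * (max (R + max ρ Dx) 0) ^ 3 + 2 * (max (R + max ρ Dx) 0) ^ 4)) * (|Dx| + |ρ| + 1)) ^
          ((2 : ℝ) / 2) *
        ENNReal.ofReal (3 * (volume : Measure E3).real (ball 0 1) *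
          (3 * M * (2 * (max (R + max ρ Dx) 0) ^ 3 + 2 * (max (R + max ρ Dx) 0) ^ 4)) * (|Dx| + |ρ| + 1)) *
        ∫⁻ y, ‖g y‖ₑ ^ (2 : ℝ) := by
  have hMnn : 0 ≤ M := (abs_nonneg _).trans (hM1 0 0)
  set ρt : ℝ := max ρ Dx with hρt
  set Dt : ℝ := max (R + ρt) 0 with hDt
  have hDt0 : 0 ≤ Dt := le_max_right _ _
  set C : ℝ := 3 * M * (2 * Dt ^ 3 + 2 * Dt ^ 4) with hC
  have hC0 : 0 ≤ C := by positivity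
  set RE : ℝ := |Dx| + |ρ| + 1 with hRE
  have hRE0 : 0 < RE := by positivity
  set m : E3 → ℝ := (ball (0 : E3) RE).indicator fun z ↦ C / ‖z‖ ^ 2 with hm
  have hk := measurable_ofReal_ball_indicator C RE
  have hCk : ∫⁻ z, ENNReal.ofReal (m z) = ENNReal.ofReal (3 * (volume : Measure E3).real (ball 0 1) * C * RE) :=
    lintegral_ball_inv_sq_majorant hC0 hRE0
  set ζ : E3 → ℝ := (closedBall (0 : E3) Dx).indicator fun _ ↦ (1 : ℝ) with hζ
  have hF : ∀ x, ζ x * ∫ y, (1 - radialCutoff ε (2 * ε) (x - y)) *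
      (bogovskiiKV η y a b (x - y) - bogovskiiKV η x a b (x - y)) * g y =
      ∫ y, (ζ x * ((1 - radialCutoff ε (2 * ε) (x - y)) *
        (bogovskiiKV η y a b (x - y) - bogovskiiKV η x a b (x - y)))) * g y := by
    intro x
    rw [← integral_const_mul]
    refine integral_congr_ae (ae_of_all _ fun y ↦ ?_)
    ring
  have hpt : ∀ x y, g y ≠ 0 → |ζ x * ((1 - radialCutoff ε (2 * ε) (x - y)) *
      (bogovskiiKV η y a b (x - y) - bogovskiiKV η x a b (x - y)))| ≤ m (x - y) := by
    intro x y hy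
    have hm0 : 0 ≤ m (x - y) := indicator_nonneg (fun z _ ↦ by positivity) _
    by_cases hx : x ∈ closedBall (0 : E3) Dx
    · rw [hζ, indicator_of_mem hx, one_mul]
      have hxn : ‖x‖ ≤ Dx := by simpa using hx
      have hyn : ‖y‖ ≤ ρ := hgρ y hy
      set z := x - y with hz
      by_cases hz0 : z = 0
      · have hxy : y = x := by rw [hz, sub_eq_zero] at hz0; exact hz0.symm
        rw [hxy, sub_self, mul_zero, abs_zero]; exact hz ▸ hm0
      · have hzn : 0 < ‖z‖ := norm_pos_iff.2 hz0
        have hzRE : z ∈ ball (0 : E3) RE := by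
          rw [mem_ball, dist_zero_right]
          calc ‖z‖ ≤ ‖x‖ + ‖y‖ := norm_sub_le x y
            _ ≤ |Dx| + |ρ| := add_le_add (hxn.trans (le_abs_self _)) (hyn.trans (le_abs_self _))
            _ < RE := by rw [hRE]; linarith
        rw [hm, indicator_of_mem hzRE, abs_mul]
        have hdiff := abs_bogovskiiKV_sub_le hη hR hM1 hM2 (ρ := ρt) (y₁ := y) (y₂ := x)
          (hyn.trans (le_max_left _ _)) (hxn.trans (le_max_right _ _)) a b hz0
        have hyx : ‖y - x‖ = ‖z‖ := by rw [hz, ← norm_neg, neg_sub]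
        rw [hyx] at hdiff
        calc _ ≤ 1 * (3 * M * ‖z‖ * (2 * Dt ^ 3 + 2 * Dt ^ 4) / ‖z‖ ^ 3) :=
              mul_le_mul (Literature.Analysis.SingularIntegrals.abs_one_sub_radialCutoff_le ε z) hdiff (abs_nonneg _)
                zero_le_one
          _ = C / ‖z‖ ^ 2 := by rw [one_mul, hC]; field_simp
    · rw [hζ, indicator_of_notMem hx, zero_mul, abs_zero]; exact hm0
  have h := lintegral_sq_le_of_conv_majorant hk hgm
    (F := fun x ↦ ζ x * ∫ y, (1 - radialCutoff ε (2 * ε) (x - y)) *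
      (bogovskiiKV η y a b (x - y) - bogovskiiKV η x a b (x - y)) * g y)
    (fun x ↦ by
      rw [hF x]
      exact enorm_integral_kernel_le (κ := fun x y ↦ ζ x * ((1 - radialCutoff ε (2 * ε) (x - y)) *
        (bogovskiiKV η y a b (x - y) - bogovskiiKV η x a b (x - y)))) x (fun y hy ↦ hpt x y hy))
  rwa [hCk] at h

end VSchurBounds


section VMainEstimate

open scoped ENNReal

variable {η : E3 → ℝ} {R : ℝ}

/-- **Measurability of the `Φ`-type operators** `x ↦ ∫ φ(x − y) (x − y)_a Q₂[ψ](x − y; y) g(y) dy`. [folklore] -/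
theorem measurable_Vop {φ ψ g : E3 → ℝ} (hφ : Continuous φ) (hψ : Continuous ψ) (hg : Continuous g) (a : Fin 3) :
    Measurable fun x : E3 ↦ ∫ y, φ (x - y) * ((x - y) a * bogovskiiQ ψ y 2 (x - y)) * g y := by
  have hK := measurable_vectorKernel_uncurry hψ a
  have m1 : Measurable fun q : E3 × E3 ↦ φ (q.1 - q.2) := hφ.measurable.comp (measurable_fst.sub measurable_snd)
  have mi : Measurable fun q : E3 × E3 ↦ (q.1 - q.2, q.2) := (measurable_fst.sub measurable_snd).prodMk measurable_snd
  have m2 : Measurable fun q : E3 × E3 ↦ (q.1 - q.2) a * bogovskiiQ ψ q.2 2 (q.1 - q.2) := (hK.comp mi :)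
  have m3 : Measurable fun q : E3 × E3 ↦ g q.2 := hg.measurable.comp measurable_snd
  have hF : Measurable fun q : E3 × E3 ↦ φ (q.1 - q.2) * ((q.1 - q.2) a * bogovskiiQ ψ q.2 2 (q.1 - q.2)) * g q.2 :=
    (m1.mul m2).mul m3
  have hS : StronglyMeasurable (uncurry fun (x y : E3) ↦ φ (x - y) * ((x - y) a * bogovskiiQ ψ y 2 (x - y)) * g y) :=
    (hF.stronglyMeasurable :)
  exact ((hS.integral_prod_right (ν := (volume : Measure E3))).measurable :)

/-- **The Calderón–Zygmund estimate for `SV_η(∂_b g)`** (the gain-one term of (T3)): for `η ∈ C⁶` vanishing off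
`B̄_R` there is `C < ∞` with `∫ |SV_η(∂_b g)_a|² ≤ C ∫ |g|²` for all `g ∈ C¹_c` supported in `B̄_ρ`.
[cite: MaoOhTao2023, Lemma 2.3 (T3)] -/
theorem exists_czConst_bogovskiiSV_pd (hη : ContDiff ℝ 6 η) (hR : ∀ z : E3, R < ‖z‖ → η z = 0) (ρ : ℝ)
    (a b : Fin 3) :
    ∃ C : ℝ≥0∞, C < ⊤ ∧ ∀ g : E3 → ℝ, ContDiff ℝ 1 g → HasCompactSupport g → (∀ y, g y ≠ 0 → ‖y‖ ≤ ρ) →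
      ∫⁻ x, ‖bogovskiiSV η (pd b g) a x‖ₑ ^ (2 : ℝ) ≤ C * ∫⁻ y, ‖g y‖ₑ ^ (2 : ℝ) := by
  have h1 : ContDiff ℝ 1 η := hη.of_le (by norm_cast)
  have h2 : ContDiff ℝ 2 η := hη.of_le (by norm_cast)
  have h3 : ContDiff ℝ 3 η := hη.of_le (by norm_cast)
  obtain ⟨M, hM0, hM1, hM2, -⟩ := exists_bound_pd_le_three h3 hR
  have hMnn : 0 ≤ M := (abs_nonneg _).trans (hM0 0)
  obtain ⟨B, hB0, hB⟩ := exists_norm_fderiv_radialCutoff_le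
  set V : ℝ := (volume : Measure E3).real (ball 0 1) with hV
  set Dx : ℝ := max (R + 2 * ρ) ρ with hDx
  set ζ : E3 → ℝ := (closedBall (0 : E3) Dx).indicator fun _ ↦ (1 : ℝ) with hζ
  have hζm : Measurable ζ := measurable_const.indicator measurableSet_closedBall
  have hζ1 : ∀ x, |ζ x| ≤ 1 := by
    intro x; simp only [hζ, indicator]; split_ifs <;> simp
  have hζD : ∀ x : E3, Dx < ‖x‖ → ζ x = 0 := by
    intro x hx
    simp only [hζ]
    rw [indicator_of_notMem]
    rw [mem_closedBall, dist_zero_right, not_le]; exact hx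
  obtain ⟨CT, hCT, hT⟩ := exists_diagFrozenVOp_l2Const hη hR a b hζm hζ1 hζD
  set A' : ℝ := 2 * M * (max (R + ρ) 0) ^ 3 with hA'
  set cB : ℝ≥0∞ := ENNReal.ofReal (B * A' * (27 * V)) with hcB
  set cL : ℝ≥0∞ := ENNReal.ofReal (3 * V * A' * (max (R + ρ) 0 + 1)) with hcL
  set cE : ℝ≥0∞ := ENNReal.ofReal (3 * V * (3 * M * (2 * (max (R + max ρ Dx) 0) ^ 3 +
    2 * (max (R + max ρ Dx) 0) ^ 4)) * (|Dx| + |ρ| + 1)) with hcE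
  set CB : ℝ≥0∞ := cB ^ ((2 : ℝ) / 2) * cB with hCB
  set CL : ℝ≥0∞ := cL ^ ((2 : ℝ) / 2) * cL with hCL
  set CE : ℝ≥0∞ := cE ^ ((2 : ℝ) / 2) * cE with hCE
  have hfin : ∀ c : ℝ≥0∞, c ≠ ⊤ → c ^ ((2 : ℝ) / 2) * c < ⊤ := fun c hc ↦
    ENNReal.mul_lt_top (ENNReal.rpow_lt_top_of_nonneg (by norm_num) hc) hc.lt_top
  set K : ℝ≥0∞ := 5 * (CT + CE + CB + CL) with hK
  have hKtop : K < ⊤ := by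
    refine ENNReal.mul_lt_top (by norm_num) ?_
    simp only [ENNReal.add_lt_top]
    exact ⟨⟨⟨hCT, hfin _ ENNReal.ofReal_ne_top⟩, hfin _ ENNReal.ofReal_ne_top⟩, hfin _ ENNReal.ofReal_ne_top⟩
  refine ⟨K, hKtop, fun g hg hgc hgρ ↦ ?_⟩
  have hgcn : Continuous g := hg.continuous
  have hpg : ContDiff ℝ 0 (pd b g) := contDiff_pd (n := 0) hg b
  have hpgc : HasCompactSupport (pd b g) := hasCompactSupport_pd hgc b
  have hpgcn : Continuous (pd b g) := hpg.continuous
  have hpgρ : ∀ y, pd b g y ≠ 0 → ‖y‖ ≤ ρ := norm_le_of_pd_ne_zero hgρ b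
  set G : ℝ≥0∞ := ∫⁻ y, ‖g y‖ₑ ^ (2 : ℝ) with hG
  set G₁ : ℝ≥0∞ := ∫⁻ y, ‖pd b g y‖ₑ ^ (2 : ℝ) with hG₁
  have hG₁ : G₁ < ⊤ := lintegral_pd_sq_lt_top hg hgc b
  set cN : ℝ := 3 * V * A' * 3 with hcN
  have hkey : ∀ ε : ℝ, 0 < ε → ∫⁻ x, ‖bogovskiiSV η (pd b g) a x‖ₑ ^ (2 : ℝ) ≤
      K * G + 5 * (ENNReal.ofReal (cN * ε) ^ ((2 : ℝ) / 2) * ENNReal.ofReal (cN * ε)) * G₁ := by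
    intro ε hε
    set N : E3 → ℝ := fun x ↦ ∫ y, radialCutoff ε (2 * ε) (x - y) * ((x - y) a * bogovskiiQ η y 2 (x - y)) * pd b g y
      with hN
    set Bt : E3 → ℝ := fun x ↦ ∫ y, fderiv ℝ (radialCutoff ε (2 * ε)) (x - y) (e b) *
      ((x - y) a * bogovskiiQ η y 2 (x - y)) * g y with hBt
    set Lt : E3 → ℝ := fun x ↦ ∫ y, (1 - radialCutoff ε (2 * ε) (x - y)) *
      ((x - y) a * bogovskiiQ (pd b η) y 2 (x - y)) * g y with hLt
    set Td : E3 → ℝ := fun x ↦ ζ x * ∫ t, (1 - radialCutoff ε (2 * ε) t) * bogovskiiKV η x a b t * g (x - t)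
      with hTd
    set Et : E3 → ℝ := fun x ↦ ζ x * ∫ y, (1 - radialCutoff ε (2 * ε) (x - y)) *
      (bogovskiiKV η y a b (x - y) - bogovskiiKV η x a b (x - y)) * g y with hEt
    have hdec : ∀ x, bogovskiiSV η (pd b g) a x = N x + (Td x + Et x - Bt x - Lt x) := by
      intro x
      rw [bogovskiiSV_pd_eq_add h3 hR hε hg hgc hgρ a b x, integral_truncV_section_mul_pd_eq h2 hR hε hg hgc a b x,
        czVTerm_eq_frozen_add h2 hR hε hgcn hgc hgρ a b x]
      simp only [hN, hTd, hEt, hBt, hLt, hζ, hDx]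
      ring
    have hpt : ∀ x, ‖bogovskiiSV η (pd b g) a x‖ₑ ^ (2 : ℝ) ≤
        5 * (‖N x‖ₑ ^ (2 : ℝ) + ‖Td x‖ₑ ^ (2 : ℝ) + ‖Et x‖ₑ ^ (2 : ℝ) + ‖Bt x‖ₑ ^ (2 : ℝ) + ‖Lt x‖ₑ ^ (2 : ℝ)) := by
      intro x
      rw [hdec x]
      refine le_trans (ENNReal.rpow_le_rpow (z := 2) ?_ (by norm_num)) (enorm_sum_five_sq_le _ _ _ _ _)
      calc ‖N x + (Td x + Et x - Bt x - Lt x)‖ₑ ≤ ‖N x‖ₑ + ‖Td x + Et x - Bt x - Lt x‖ₑ := enorm_add_le _ _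
        _ ≤ ‖N x‖ₑ + (‖Td x + Et x - Bt x‖ₑ + ‖Lt x‖ₑ) := by gcongr; exact enorm_sub_le
        _ ≤ ‖N x‖ₑ + ((‖Td x + Et x‖ₑ + ‖Bt x‖ₑ) + ‖Lt x‖ₑ) := by gcongr; exact enorm_sub_le
        _ ≤ ‖N x‖ₑ + (((‖Td x‖ₑ + ‖Et x‖ₑ) + ‖Bt x‖ₑ) + ‖Lt x‖ₑ) := by gcongr; exact enorm_add_le _ _
        _ = _ := by ring
    have hθc : Continuous (radialCutoff ε (2 * ε) : E3 → ℝ) := (radialCutoff_contDiff (n := 0) ε (2 * ε)).continuous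
    have hθ1 : ContDiff ℝ 1 (radialCutoff ε (2 * ε) : E3 → ℝ) := radialCutoff_contDiff ε (2 * ε)
    have mN : Measurable fun x ↦ ‖N x‖ₑ ^ (2 : ℝ) :=
      (measurable_Vop hθc hη.continuous hpgcn a).enorm.pow_const _
    have mB : Measurable fun x ↦ ‖Bt x‖ₑ ^ (2 : ℝ) :=
      (measurable_Vop ((hθ1.continuous_fderiv one_ne_zero).clm_apply continuous_const) hη.continuous hgcn
        a).enorm.pow_const _
    have hbηc : Continuous (pd b η) := (contDiff_pd (n := 0) h1 b).continuous
    have mL : Measurable fun x ↦ ‖Lt x‖ₑ ^ (2 : ℝ) :=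
      (measurable_Vop (continuous_const.sub hθc) hbηc hgcn a).enorm.pow_const _
    have mT : Measurable fun x ↦ ‖Td x‖ₑ ^ (2 : ℝ) := by
      have hm := measurable_frozenVOp_uncurry h1 ε hgcn a b (g := g)
      have hdiag : Measurable fun x : E3 ↦
          ∫ t, (1 - radialCutoff ε (2 * ε) t) * bogovskiiKV η x a b t * g (x - t) :=
        (hm.comp (measurable_id.prodMk measurable_id) :)
      exact (hζm.mul hdiag).enorm.pow_const _
    have hsum : ∫⁻ x, ‖bogovskiiSV η (pd b g) a x‖ₑ ^ (2 : ℝ) ≤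
        5 * ((∫⁻ x, ‖N x‖ₑ ^ (2 : ℝ)) + (∫⁻ x, ‖Td x‖ₑ ^ (2 : ℝ)) + (∫⁻ x, ‖Et x‖ₑ ^ (2 : ℝ)) +
          (∫⁻ x, ‖Bt x‖ₑ ^ (2 : ℝ)) + ∫⁻ x, ‖Lt x‖ₑ ^ (2 : ℝ)) := by
      calc _ ≤ ∫⁻ x, 5 * (‖N x‖ₑ ^ (2 : ℝ) + ‖Td x‖ₑ ^ (2 : ℝ) + ‖Et x‖ₑ ^ (2 : ℝ) + ‖Bt x‖ₑ ^ (2 : ℝ) +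
            ‖Lt x‖ₑ ^ (2 : ℝ)) := lintegral_mono hpt
        _ = 5 * ∫⁻ x, (‖N x‖ₑ ^ (2 : ℝ) + ‖Td x‖ₑ ^ (2 : ℝ) + ‖Et x‖ₑ ^ (2 : ℝ) + ‖Bt x‖ₑ ^ (2 : ℝ) +
            ‖Lt x‖ₑ ^ (2 : ℝ)) := by
            rw [lintegral_const_mul' _ _ (by norm_num)]
        _ = 5 * ((∫⁻ x, ‖N x‖ₑ ^ (2 : ℝ) + ‖Td x‖ₑ ^ (2 : ℝ) + ‖Et x‖ₑ ^ (2 : ℝ) + ‖Bt x‖ₑ ^ (2 : ℝ)) +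
            ∫⁻ x, ‖Lt x‖ₑ ^ (2 : ℝ)) := by
            congr 1
            rw [← lintegral_add_right _ mL]
        _ = 5 * ((∫⁻ x, ‖N x‖ₑ ^ (2 : ℝ) + ‖Td x‖ₑ ^ (2 : ℝ) + ‖Et x‖ₑ ^ (2 : ℝ)) + (∫⁻ x, ‖Bt x‖ₑ ^ (2 : ℝ)) +
            ∫⁻ x, ‖Lt x‖ₑ ^ (2 : ℝ)) := by
            congr 2
            rw [← lintegral_add_right _ mB]
        _ = 5 * ((∫⁻ x, ‖N x‖ₑ ^ (2 : ℝ) + ‖Td x‖ₑ ^ (2 : ℝ)) + (∫⁻ x, ‖Et x‖ₑ ^ (2 : ℝ)) +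
            (∫⁻ x, ‖Bt x‖ₑ ^ (2 : ℝ)) + ∫⁻ x, ‖Lt x‖ₑ ^ (2 : ℝ)) := by
            congr 3
            have mNT : Measurable fun x ↦ ‖N x‖ₑ ^ (2 : ℝ) + ‖Td x‖ₑ ^ (2 : ℝ) := mN.add mT
            rw [← lintegral_add_left mNT]
        _ = _ := by
            congr 4
            rw [← lintegral_add_left mN]
    have bN := lintegral_sq_thetaV_le hη.continuous hR hM0 hε hpgcn.measurable hpgρ a
    have bB := lintegral_sq_dthetaV_le hη.continuous hR hM0 hB0 hB hε hgcn.measurable hgρ a b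
    have bL := lintegral_sq_truncVpd_le h1 hR hM1 ε hgcn.measurable hgρ a b
    have bE := lintegral_sq_freezeVError_le h2 hR hM1 hM2 ε (Dx := Dx) hgcn.measurable hgρ a b
    have bT := hT ε hε g hgcn hgc
    have bN' : ∫⁻ x, ‖N x‖ₑ ^ (2 : ℝ) ≤ ENNReal.ofReal (cN * ε) ^ ((2 : ℝ) / 2) * ENNReal.ofReal (cN * ε) * G₁ := by
      have : cN * ε = 3 * V * A' * (3 * ε) := by rw [hcN]; ring
      rw [this]; exact bN
    have bB' : ∫⁻ x, ‖Bt x‖ₑ ^ (2 : ℝ) ≤ CB * G := bB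
    have bL' : ∫⁻ x, ‖Lt x‖ₑ ^ (2 : ℝ) ≤ CL * G := bL
    have bE' : ∫⁻ x, ‖Et x‖ₑ ^ (2 : ℝ) ≤ CE * G := bE
    have bT' : ∫⁻ x, ‖Td x‖ₑ ^ (2 : ℝ) ≤ CT * G := bT
    calc _ ≤ _ := hsum
      _ ≤ 5 * ((ENNReal.ofReal (cN * ε) ^ ((2 : ℝ) / 2) * ENNReal.ofReal (cN * ε) * G₁) + CT * G + CE * G +
          CB * G + CL * G) := by gcongr
      _ = K * G + 5 * (ENNReal.ofReal (cN * ε) ^ ((2 : ℝ) / 2) * ENNReal.ofReal (cN * ε)) * G₁ := by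
          rw [hK]; ring
  have hlim : Tendsto (fun ε : ℝ ↦ K * G + 5 * (ENNReal.ofReal (cN * ε) ^ ((2 : ℝ) / 2) * ENNReal.ofReal (cN * ε)) * G₁)
      (𝓝[>] 0) (𝓝 (K * G)) := by
    have h0 : Tendsto (fun ε : ℝ ↦ ENNReal.ofReal (cN * ε)) (𝓝[>] 0) (𝓝 0) := by
      have : Tendsto (fun ε : ℝ ↦ cN * ε) (𝓝 0) (𝓝 (cN * 0)) := (continuous_const.mul continuous_id).tendsto 0
      rw [mul_zero] at this
      have h := ENNReal.tendsto_ofReal this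
      rw [ENNReal.ofReal_zero] at h
      exact h.mono_left nhdsWithin_le_nhds
    have h0' : Tendsto (fun ε : ℝ ↦ ENNReal.ofReal (cN * ε) ^ ((2 : ℝ) / 2)) (𝓝[>] 0) (𝓝 0) := by
      have : ∀ ε : ℝ, ENNReal.ofReal (cN * ε) ^ ((2 : ℝ) / 2) = ENNReal.ofReal (cN * ε) := by
        intro ε; norm_num
      simp only [this]; exact h0
    have hprod : Tendsto (fun ε : ℝ ↦ ENNReal.ofReal (cN * ε) ^ ((2 : ℝ) / 2) * ENNReal.ofReal (cN * ε)) (𝓝[>] 0)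
        (𝓝 (0 * 0)) := ENNReal.Tendsto.mul h0' (Or.inr ENNReal.zero_ne_top) h0 (Or.inr ENNReal.zero_ne_top)
    rw [zero_mul] at hprod
    have h5 : Tendsto (fun ε : ℝ ↦ 5 * (ENNReal.ofReal (cN * ε) ^ ((2 : ℝ) / 2) * ENNReal.ofReal (cN * ε)))
        (𝓝[>] 0) (𝓝 (5 * 0)) := ENNReal.Tendsto.const_mul hprod (Or.inr (by norm_num))
    rw [mul_zero] at h5
    have h5G : Tendsto (fun ε : ℝ ↦ 5 * (ENNReal.ofReal (cN * ε) ^ ((2 : ℝ) / 2) * ENNReal.ofReal (cN * ε)) * G₁)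
        (𝓝[>] 0) (𝓝 (0 * G₁)) := ENNReal.Tendsto.mul_const h5 (Or.inr hG₁.ne)
    rw [zero_mul] at h5G
    have := h5G.const_add (K * G)
    rwa [add_zero] at this
  refine ge_of_tendsto hlim ?_
  filter_upwards [self_mem_nhdsWithin] with ε hε
  exact hkey ε hε

end VMainEstimate

section T3GainOne

open scoped ENNReal

variable {η : E3 → ℝ} {R : ℝ}

/-- **Gain of one derivative for the vector operator `SV_η`**: for `η ∈ C⁶` vanishing off `B̄_R` and every `ρ`
there is `C < ∞` with `∫ |∂_b (SV_η g)_a|² ≤ C ∫ |g|²` for all `g ∈ C¹_c` supported in `B̄_ρ` and all `a, b`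
(`∂_b SV_η g = SV_{∂_bη} g + SV_η(∂_b g)`: `exists_l2Const_bogovskiiSV` and `exists_czConst_bogovskiiSV_pd`).
[cite: MaoOhTao2023, Lemma 2.3 (T3)] -/
theorem exists_h1Const_bogovskiiSV (hη : ContDiff ℝ 6 η) (hR : ∀ z : E3, R < ‖z‖ → η z = 0) (ρ : ℝ) :
    ∃ C : ℝ≥0∞, C < ⊤ ∧ ∀ (g : E3 → ℝ), ContDiff ℝ 1 g → HasCompactSupport g → (∀ y, g y ≠ 0 → ‖y‖ ≤ ρ) →
      ∀ a b : Fin 3, ∫⁻ x : E3, ‖pd b (bogovskiiSV η g a) x‖ₑ ^ (2 : ℝ) ≤ C * ∫⁻ y : E3, ‖g y‖ₑ ^ (2 : ℝ) := by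
  have h1 : ContDiff ℝ 1 η := hη.of_le (by norm_cast)
  have hb : ∀ b : Fin 3, ∃ C : ℝ≥0∞, C < ⊤ ∧ ∀ (f : E3 → ℝ), Continuous f → (∀ y, f y ≠ 0 → ‖y‖ ≤ ρ) →
      ∀ a : Fin 3, ∫⁻ x : E3, ‖bogovskiiSV (pd b η) f a x‖ₑ ^ (2 : ℝ) ≤ C * ∫⁻ y : E3, ‖f y‖ₑ ^ (2 : ℝ) := fun b ↦
    exists_l2Const_bogovskiiSV (contDiff_pd (n := 0) h1 b).continuous (pd_eta_admissible hR b) ρ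
  choose C1 hC1 hH1 using hb
  have hq : ∀ q : Fin 3 × Fin 3, ∃ C : ℝ≥0∞, C < ⊤ ∧ ∀ g : E3 → ℝ, ContDiff ℝ 1 g → HasCompactSupport g →
      (∀ y, g y ≠ 0 → ‖y‖ ≤ ρ) → ∫⁻ x, ‖bogovskiiSV η (pd q.2 g) q.1 x‖ₑ ^ (2 : ℝ) ≤ C * ∫⁻ y, ‖g y‖ₑ ^ (2 : ℝ) :=
    fun q ↦ exists_czConst_bogovskiiSV_pd hη hR ρ q.1 q.2
  choose C2 hC2 hH2 using hq
  set S1 : ℝ≥0∞ := Finset.univ.sup C1 with hS1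
  set S2 : ℝ≥0∞ := Finset.univ.sup C2 with hS2
  have hS1top : S1 < ⊤ := (Finset.sup_lt_iff bot_lt_top).2 fun b _ ↦ hC1 b
  have hS2top : S2 < ⊤ := (Finset.sup_lt_iff bot_lt_top).2 fun q _ ↦ hC2 q
  refine ⟨2 * (S1 + S2), ENNReal.mul_lt_top (by norm_num) (ENNReal.add_lt_top.2 ⟨hS1top, hS2top⟩), ?_⟩
  intro g hg hgc hgρ a b
  have hgcn : Continuous g := hg.continuous
  set u : E3 → ℝ := bogovskiiSV (pd b η) g a with hu
  set v : E3 → ℝ := bogovskiiSV η (pd b g) a with hv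
  have hsplit : ∀ x, pd b (bogovskiiSV η g a) x = u x + v x := fun x ↦ by
    rw [pd_bogovskiiSV h1 hR hg hgc a b]
  have hmu : Measurable fun x ↦ ‖u x‖ₑ ^ (2 : ℝ) := by
    have : Continuous u := continuous_bogovskiiVOperator (contDiff_pd (n := 0) h1 b).continuous
      (pd_eta_admissible hR b) hgcn hgc a
    exact this.measurable.enorm.pow_const _
  set G : ℝ≥0∞ := ∫⁻ y, ‖g y‖ₑ ^ (2 : ℝ) with hG
  have bu : ∫⁻ x, ‖u x‖ₑ ^ (2 : ℝ) ≤ S1 * G :=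
    (hH1 b g hgcn hgρ a).trans (by gcongr; exact Finset.le_sup (Finset.mem_univ b))
  have bv : ∫⁻ x, ‖v x‖ₑ ^ (2 : ℝ) ≤ S2 * G :=
    (hH2 (a, b) g hg hgc hgρ).trans (by gcongr; exact Finset.le_sup (Finset.mem_univ (a, b)))
  calc ∫⁻ x, ‖pd b (bogovskiiSV η g a) x‖ₑ ^ (2 : ℝ)
      ≤ ∫⁻ x, 2 * (‖u x‖ₑ ^ (2 : ℝ) + ‖v x‖ₑ ^ (2 : ℝ)) := by
        refine lintegral_mono fun x ↦ ?_
        rw [hsplit x]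
        exact (ENNReal.rpow_le_rpow (enorm_add_le _ _) (by norm_num)).trans (enorm_add_sq_le _ _)
    _ = 2 * ((∫⁻ x, ‖u x‖ₑ ^ (2 : ℝ)) + ∫⁻ x, ‖v x‖ₑ ^ (2 : ℝ)) := by
        rw [lintegral_const_mul' _ _ (by norm_num), lintegral_add_left hmu]
    _ ≤ 2 * (S1 * G + S2 * G) := by gcongr
    _ = 2 * (S1 + S2) * G := by ring

/-- `(a + b + c)² ≤ 3(a² + b² + c²)` in `ℝ≥0∞`. [folklore] -/
theorem enorm_add_three_sq_le (a b c : ℝ≥0∞) :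
    (a + b + c) ^ (2 : ℝ) ≤ 3 * (a ^ (2 : ℝ) + b ^ (2 : ℝ) + c ^ (2 : ℝ)) := by
  have h := enorm_sum_three_sq_le ![a, b, c]
  simp only [Fin.sum_univ_three, Matrix.cons_val_zero, Matrix.cons_val_one, Matrix.cons_val] at h
  exact h

/-- **(T3), gain of one derivative at the `L²` level**: for `η ∈ C⁷` vanishing off `B̄_R` and every `ρ` there is
`C < ∞` with `∫ |∂_l (T_η F)^{ij}|² ≤ C Σ_k ∫ |F_k|²` for all `F ∈ C²_c` supported in `B̄_ρ` and all `i, j, l` — the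
operator `T_η` maps `L²(B̄_ρ)` boundedly into `Ḣ¹` (Mao–Oh–Tao, Lemma 2.3, estimate (T3) with `s = 0`, on the dense
class `C²_c`). Proof: `∂_l T F` is a combination of `∂_l SV_η F` (gain one, `exists_h1Const_bogovskiiSV`) and
`∂_l∂_m S_η F` (gain two, `exists_h2Const_bogovskiiS`), `pd_bogovskiiT`. [cite: MaoOhTao2023, Lemma 2.3 (T3)] -/
theorem exists_h1Const_bogovskiiT (hη : ContDiff ℝ 7 η) (hR : ∀ z : E3, R < ‖z‖ → η z = 0) (ρ : ℝ) :
    ∃ C : ℝ≥0∞, C < ⊤ ∧ ∀ (F : Fin 3 → E3 → ℝ), (∀ k, ContDiff ℝ 2 (F k)) → (∀ k, HasCompactSupport (F k)) →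
      (∀ k y, F k y ≠ 0 → ‖y‖ ≤ ρ) → ∀ i j l : Fin 3,
        ∫⁻ x : E3, ‖pd l (bogovskiiT η F i j) x‖ₑ ^ (2 : ℝ) ≤ C * ∑ k, ∫⁻ y : E3, ‖F k y‖ₑ ^ (2 : ℝ) := by
  have h2 : ContDiff ℝ 2 η := hη.of_le (by norm_cast)
  have h6 : ContDiff ℝ 6 η := hη.of_le (by norm_cast)
  obtain ⟨CV, hCV, hHV⟩ := exists_h1Const_bogovskiiSV h6 hR ρ
  obtain ⟨CS, hCS, hHS⟩ := exists_h2Const_bogovskiiS hη hR ρ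
  refine ⟨3 * (4 * CV + 36 * CS + 9 * CS), ?_, ?_⟩
  · refine ENNReal.mul_lt_top (by norm_num) (ENNReal.add_lt_top.2 ⟨ENNReal.add_lt_top.2 ⟨?_, ?_⟩, ?_⟩) <;>
      exact ENNReal.mul_lt_top (by norm_num) (by assumption)
  intro F hF hFc hFρ i j l
  have hF1 : ∀ k, ContDiff ℝ 1 (F k) := fun k ↦ (hF k).of_le (by norm_cast)
  set G : Fin 3 → ℝ≥0∞ := fun k ↦ ∫⁻ y, ‖F k y‖ₑ ^ (2 : ℝ) with hG
  set SG : ℝ≥0∞ := ∑ k, G k with hSG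
  have hGle : ∀ k, G k ≤ SG := fun k ↦ Finset.single_le_sum (f := G) (fun _ _ ↦ by positivity) (Finset.mem_univ k)
  -- the pieces
  set A1 : E3 → ℝ≥0∞ := fun x ↦ ‖pd l (bogovskiiSV η (F j) i) x‖ₑ ^ (2 : ℝ) with hA1
  set A2 : E3 → ℝ≥0∞ := fun x ↦ ‖pd l (bogovskiiSV η (F i) j) x‖ₑ ^ (2 : ℝ) with hA2
  set B1 : Fin 3 → E3 → ℝ≥0∞ := fun m x ↦ ‖pd l (pd m (bogovskiiS η (F j) i m)) x‖ₑ ^ (2 : ℝ) with hB1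
  set B2 : Fin 3 → E3 → ℝ≥0∞ := fun m x ↦ ‖pd l (pd m (bogovskiiS η (F i) j m)) x‖ₑ ^ (2 : ℝ) with hB2
  set Cc : Fin 3 → E3 → ℝ≥0∞ := fun k x ↦ ‖pd l (pd k (bogovskiiS η (F k) i j)) x‖ₑ ^ (2 : ℝ) with hCc
  have cSV : ∀ k a, Continuous (pd l (bogovskiiSV η (F k) a)) := fun k a ↦ by
    have h := contDiff_one_bogovskiiSV (h2.of_le (by norm_cast)) hR (hF1 k) (hFc k) a
    unfold pd; exact (h.continuous_fderiv one_ne_zero).clm_apply continuous_const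
  have cSS : ∀ k a c m, Continuous (pd l (pd m (bogovskiiS η (F k) a c))) := fun k a c m ↦ by
    have h : ContDiff ℝ 1 (pd m (bogovskiiS η (F k) a c)) :=
      contDiff_pd (n := 1) (contDiff_two_bogovskiiS h2 hR (hF k) (hFc k) a c) m
    unfold pd; exact (h.continuous_fderiv one_ne_zero).clm_apply continuous_const
  have mA1 : Measurable A1 := (cSV j i).measurable.enorm.pow_const _
  have mA2 : Measurable A2 := (cSV i j).measurable.enorm.pow_const _
  have mB1 : ∀ m, Measurable (B1 m) := fun m ↦ (cSS j i m m).measurable.enorm.pow_const _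
  have mB2 : ∀ m, Measurable (B2 m) := fun m ↦ (cSS i j m m).measurable.enorm.pow_const _
  have mCc : ∀ k, Measurable (Cc k) := fun k ↦ (cSS k i j k).measurable.enorm.pow_const _
  have half_le : ‖(1 / 2 : ℝ)‖ₑ ≤ 1 := by
    rw [← ofReal_norm]; exact ENNReal.ofReal_le_one.2 (by norm_num)
  -- pointwise bound
  have hpt : ∀ x, ‖pd l (bogovskiiT η F i j) x‖ₑ ^ (2 : ℝ) ≤
      3 * (2 * (A1 x + A2 x) + 3 * ∑ m, 2 * (B1 m x + B2 m x) + 3 * ∑ k, Cc k x) := by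
    intro x
    rw [pd_bogovskiiT h2 hR hF hFc i j l x]
    set p1 : ℝ := (1 / 2 : ℝ) * (pd l (bogovskiiSV η (F j) i) x + pd l (bogovskiiSV η (F i) j) x) with hp1
    set p2 : ℝ := (1 / 2 : ℝ) *
      ∑ m, (pd l (pd m (bogovskiiS η (F j) i m)) x + pd l (pd m (bogovskiiS η (F i) j m)) x) with hp2
    set p3 : ℝ := ∑ k, pd l (pd k (bogovskiiS η (F k) i j)) x with hp3
    have e1 : ‖p1‖ₑ ^ (2 : ℝ) ≤ 2 * (A1 x + A2 x) := by
      rw [hp1, enorm_mul]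
      calc _ ≤ (1 * ‖pd l (bogovskiiSV η (F j) i) x + pd l (bogovskiiSV η (F i) j) x‖ₑ) ^ (2 : ℝ) := by gcongr
        _ ≤ _ := by
            rw [one_mul]
            exact (ENNReal.rpow_le_rpow (enorm_add_le _ _) (by norm_num)).trans (enorm_add_sq_le _ _)
    have e2 : ‖p2‖ₑ ^ (2 : ℝ) ≤ 3 * ∑ m, 2 * (B1 m x + B2 m x) := by
      rw [hp2, enorm_mul]
      calc _ ≤ (1 * ‖∑ m, (pd l (pd m (bogovskiiS η (F j) i m)) x + pd l (pd m (bogovskiiS η (F i) j m)) x)‖ₑ) ^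
            (2 : ℝ) := by gcongr
        _ ≤ (∑ m, ‖pd l (pd m (bogovskiiS η (F j) i m)) x + pd l (pd m (bogovskiiS η (F i) j m)) x‖ₑ) ^ (2 : ℝ) := by
            rw [one_mul]; exact ENNReal.rpow_le_rpow (enorm_sum_le _ _) (by norm_num)
        _ ≤ 3 * ∑ m, ‖pd l (pd m (bogovskiiS η (F j) i m)) x + pd l (pd m (bogovskiiS η (F i) j m)) x‖ₑ ^ (2 : ℝ) :=
            enorm_sum_three_sq_le _
        _ ≤ _ := by
            gcongr with m
            exact (ENNReal.rpow_le_rpow (enorm_add_le _ _) (by norm_num)).trans (enorm_add_sq_le _ _)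
    have e3 : ‖p3‖ₑ ^ (2 : ℝ) ≤ 3 * ∑ k, Cc k x := by
      rw [hp3]
      calc _ ≤ (∑ k, ‖pd l (pd k (bogovskiiS η (F k) i j)) x‖ₑ) ^ (2 : ℝ) :=
            ENNReal.rpow_le_rpow (enorm_sum_le _ _) (by norm_num)
        _ ≤ _ := enorm_sum_three_sq_le _
    calc ‖p1 + p2 - p3‖ₑ ^ (2 : ℝ) ≤ (‖p1‖ₑ + ‖p2‖ₑ + ‖p3‖ₑ) ^ (2 : ℝ) := by
          refine ENNReal.rpow_le_rpow ?_ (by norm_num)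
          exact (enorm_sub_le).trans (add_le_add (enorm_add_le _ _) le_rfl)
      _ ≤ 3 * (‖p1‖ₑ ^ (2 : ℝ) + ‖p2‖ₑ ^ (2 : ℝ) + ‖p3‖ₑ ^ (2 : ℝ)) := enorm_add_three_sq_le _ _ _
      _ ≤ _ := by gcongr
  -- integrate
  have hmid : Measurable fun x ↦ 3 * ∑ m, 2 * (B1 m x + B2 m x) :=
    (Finset.measurable_sum _ fun m _ ↦ ((mB1 m).add (mB2 m)).const_mul _).const_mul _
  have hfirst : Measurable fun x ↦ 2 * (A1 x + A2 x) := (mA1.add mA2).const_mul _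
  have h12 : Measurable fun x ↦ 2 * (A1 x + A2 x) + 3 * ∑ m, 2 * (B1 m x + B2 m x) := hfirst.add hmid
  have hBm : ∀ m, Measurable fun x ↦ 2 * (B1 m x + B2 m x) := fun m ↦ ((mB1 m).add (mB2 m)).const_mul _
  have hBint : ∀ m, ∫⁻ x, 2 * (B1 m x + B2 m x) = 2 * ((∫⁻ x, B1 m x) + ∫⁻ x, B2 m x) := fun m ↦ by
    rw [lintegral_const_mul' _ _ (by norm_num), lintegral_add_left (mB1 m)]
  have hint : ∫⁻ x, 3 * (2 * (A1 x + A2 x) + 3 * ∑ m, 2 * (B1 m x + B2 m x) + 3 * ∑ k, Cc k x) =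
      3 * (2 * ((∫⁻ x, A1 x) + ∫⁻ x, A2 x) + 3 * ∑ m, 2 * ((∫⁻ x, B1 m x) + ∫⁻ x, B2 m x) +
        3 * ∑ k, ∫⁻ x, Cc k x) := by
    rw [lintegral_const_mul' _ _ (by norm_num), lintegral_add_left h12, lintegral_add_left hfirst,
      lintegral_const_mul' _ _ (by norm_num), lintegral_add_left mA1, lintegral_const_mul' _ _ (by norm_num),
      lintegral_finsetSum _ (fun m _ ↦ hBm m),
      lintegral_const_mul' _ _ (by norm_num), lintegral_finsetSum _ (fun k _ ↦ mCc k)]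
    simp only [hBint]
  have bA1 : ∫⁻ x, A1 x ≤ CV * SG := (hHV (F j) (hF1 j) (hFc j) (hFρ j) i l).trans (by gcongr; exact hGle j)
  have bA2 : ∫⁻ x, A2 x ≤ CV * SG := (hHV (F i) (hF1 i) (hFc i) (hFρ i) j l).trans (by gcongr; exact hGle i)
  have bB1 : ∀ m, ∫⁻ x, B1 m x ≤ CS * SG := fun m ↦
    (hHS (F j) (hF j) (hFc j) (hFρ j) i m l m).trans (by gcongr; exact hGle j)
  have bB2 : ∀ m, ∫⁻ x, B2 m x ≤ CS * SG := fun m ↦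
    (hHS (F i) (hF i) (hFc i) (hFρ i) j m l m).trans (by gcongr; exact hGle i)
  have bCc : ∀ k, ∫⁻ x, Cc k x ≤ CS * SG := fun k ↦
    (hHS (F k) (hF k) (hFc k) (hFρ k) i j l k).trans (by gcongr; exact hGle k)
  have s1 : 2 * ((∫⁻ x, A1 x) + ∫⁻ x, A2 x) ≤ 2 * (CV * SG + CV * SG) := by gcongr
  have s2 : ∑ m, 2 * ((∫⁻ x, B1 m x) + ∫⁻ x, B2 m x) ≤ ∑ _m : Fin 3, 2 * (CS * SG + CS * SG) :=
    Finset.sum_le_sum fun m _ ↦ by have := bB1 m; have := bB2 m; gcongr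
  have s3 : ∑ k, ∫⁻ x, Cc k x ≤ ∑ _k : Fin 3, CS * SG := Finset.sum_le_sum fun k _ ↦ bCc k
  have s123 : 3 * (2 * ((∫⁻ x, A1 x) + ∫⁻ x, A2 x) + 3 * ∑ m, 2 * ((∫⁻ x, B1 m x) + ∫⁻ x, B2 m x) +
      3 * ∑ k, ∫⁻ x, Cc k x) ≤
      3 * (2 * (CV * SG + CV * SG) + 3 * ∑ _m : Fin 3, 2 * (CS * SG + CS * SG) + 3 * ∑ _k : Fin 3, CS * SG) :=
    by gcongr
  calc ∫⁻ x, ‖pd l (bogovskiiT η F i j) x‖ₑ ^ (2 : ℝ)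
      ≤ ∫⁻ x, 3 * (2 * (A1 x + A2 x) + 3 * ∑ m, 2 * (B1 m x + B2 m x) + 3 * ∑ k, Cc k x) := lintegral_mono hpt
    _ = _ := hint
    _ ≤ _ := s123
    _ = 3 * (4 * CV + 36 * CS + 9 * CS) * SG := by
        simp only [Finset.sum_const, Finset.card_univ, Fintype.card_fin, nsmul_eq_mul]
        push_cast
        ring

end T3GainOne

end MaoOhTao

end Literature.Geometry.Lorentzian
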